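import Mathlib
import Summits.CriticalPhenomena.CardyFormulaZ2.Theses.CardyMagicRigidity
import Summits.CriticalPhenomena.CardyFormulaZ2.Theorems.CardyMagicRigidityHexSegmentDefs
import Summits.CriticalPhenomena.CardyFormulaZ2.Theorems.CardyMagicRigidityLoopLimitZ2EqTCoinMeasurable
import Summits.CriticalPhenomena.CardyFormulaZ2.Theorems.CardyMagicRigidityLoopLimitZ2EqTBondEnd
import Summits.CriticalPhenomena.CardyFormulaZ2.Theorems.CardyMagicRigidityLoopLimitZ2EqTFlatOfSymmetry
import Summits.CriticalPhenomena.CardyFormulaZ2.Theorems.CardyMagicRigidityLoopLimitZ2EqTSiteEnd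
import Summits.CriticalPhenomena.CardyFormulaZ2.Theorems.CardyMagicRigidityLoopLimitZ2EqTChainGlue
import Summits.CriticalPhenomena.CardyFormulaZ2.Theorems.CardyMagicRigidityLoopLimitZ2EqTRussoMixture
import Summits.CriticalPhenomena.CardyFormulaZ2.Theorems.CardyMagicRigidityLoopLimitZ2EqTSiteEndCrossings
import Literature.Probability.Percolation.FullPlaneCNL
import Literature.Probability.RandomPlanarGeometry.LoopConfigurationsMetric
import HarnessLib

/-!
# Conditional closure of the crux `LoopLimitZ2EqT` along line `Sketch` (the two-leg Chayes–Lei chain)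
# — stmt-CriticalPhenomena-4833, route `CardyMagicRigidity`, sub-problem `CriticalPhenomena/CardyFormulaZ2`

The crux, by name: `Summit.CriticalPhenomena.CardyFormulaZ2.Theses.CardyMagicRigidity.LoopLimitZ2EqT`
≡ `d_CN((P^bond_{1/2}, bondLoopConfig δ 0), (P^site_{1/2}, siteLoopConfig δ)) → 0` as `δ → 0⁺`
(full-plane loop universality bond-`ℤ²` ~ site-`𝕋`; an OPEN PROBLEM of the Schramm ICM 2006 Problem
2.11 class).

This file is the sorry-free COMPOSITION of the registered skeleton
`Cruxes/LoopLimitZ2EqT/Lines/Sketch.lean` (r6; vocabulary and stub statements in the definitions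
module `Theorems/CardyMagicRigidityHexSegmentDefs.lean`, §1 and §3), written over the LANDED stubs
S1 `stub_bondEnd`, S2 `stub_siteEnd`, S3 `stub_coinMeasurable`, S5a `stub_russoMixture`,
S6 `stub_flatOfSymmetry`, S7a `stub_siteEndCrossings` and the landed chain glue
`loopLimitZ2EqT_of_stubs`, with the three residual statements of the line as HYPOTHESES:

* S4 `TriToSquareLoops` — isoradial transport bond-`ℤ²` ~ bond-`𝕋̃` at loop level (the `(ℤ², 𝕋̃)`,
  `q = 1` instance of the announced, unpublished 3-direction extension [HM24] of DKKMO Thm 1.7;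
  Manolescu arXiv:2502.08394 Rem 5.6);
* S5b `InfluenceVanishes` — the research content: the total type influence along the C₃-symmetric
  self-dual segment `M_t` vanishes uniformly (universality along the Chayes–Lei self-dual hexagon
  family; open);
* S7c `CardyToCLE := BondEndCrossings → BondEndLoops` — the Camia–Newman CLE₆ pipeline for critical
  bond percolation on `𝕋̃`, relative to site-`𝕋` (no published source for `𝕋̃`; crux-sized).

Main results (all unconditional implications, kernel-checked):

* `loopLimitZ2EqT_of_bondEndLoops : TriToSquareLoops → BondEndLoops → LoopLimitZ2EqT` — the crux
  factors through exactly two loop-level universality statements, "bond-`ℤ²` ~ bond-`𝕋̃`" and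
  "bond-`𝕋̃` ~ site-`𝕋`" (gluing through the landed S1, S2, S3 by `cnLawEDist_triangle`);
* `loopLimitZ2EqT_of_residuals : TriToSquareLoops → InfluenceVanishes → CardyToCLE → LoopLimitZ2EqT`
  — the line's composition: S5b ⇒(S5a) S5 ⇒(S6) flatness ⇒(S7a, S7b) Cardy for `M₁` ⇒(S7c) loop
  level ⇒ the crux;
* `loopLimitZ2EqT_of_residuals'` — the same over S5 `UniformAttachmentSymmetry` instead of S5b.

So the crux is CLOSED MODULO {S4, S5b, S7c}: one unpublished theorem of known type, one open
one-lattice universality statement, one XL transfer of standard type. Nothing in this file is a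
named Literature fact; its trust base is empty (the hypotheses are explicit).
-/

noncomputable section

open MeasureTheory Set Filter Metric
open scoped Real Topology ENNReal BigOperators

namespace Summit.CriticalPhenomena.CardyFormulaZ2.Cruxes.LoopLimitZ2EqT.HexSegment

open Literature.Probability.RandomPlanarGeometry Literature.Probability.Percolation
  Literature.Probability.LatticeModels
open _root_.Summit.CriticalPhenomena.CardyFormulaZ2.Theses.CardyMagicRigidity (LoopLimitZ2EqT)

/-! ## §1 The crossing-level chain at the bond end: S5b ⇒ S5 ⇒ flatness ⇒ Cardy for `M₁` -/

/-- **S5b ⇒ S5.** The total type influence IS the `t`-derivative within `[0,1]` of the crude crossing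
probability (the landed Russo formula for the mixture, S5a `stub_russoMixture`, read through
`HasDerivWithinAt.derivWithin` and `uniqueDiffOn_Icc`), so uniform vanishing of the influence is
uniform vanishing of the derivative: `InfluenceVanishes → UniformAttachmentSymmetry`. -/
theorem uniformAttachmentSymmetry_of_influenceVanishes (h : InfluenceVanishes) :
    UniformAttachmentSymmetry := by
  intro R ε hε
  obtain ⟨δ₀, hδ₀, h⟩ := h R ε hε
  refine ⟨δ₀, hδ₀, fun δ hδ t ht ↦ ?_⟩
  rw [(stub_russoMixture R δ hδ.1 t ht).derivWithin (uniqueDiffOn_Icc zero_lt_one t ht)]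
  exact h δ hδ t ht

/-- **S7b: flatness ⇒ Cardy for `M₁`.** Along the segment the crude crossing probabilities of `M₁`
and `M₀` merge (`HexSegmentFlat` at `t = 1`), and those of `M₀` converge to Cardy's `F(η)` in every
conformal rectangle (the landed crossing-level site end S7a `stub_siteEndCrossings`); hence so do
those of `M₁`: `segCross 1 R = (segCross 1 R − segCross 0 R) + segCross 0 R → 0 + F(η)`. -/
theorem bondEndCrossings_of_hexSegmentFlat (hflat : HexSegmentFlat) : BondEndCrossings := by
  intro R φ x hux
  have h := (hflat 1 R).add (stub_siteEndCrossings R φ x hux)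
  simpa only [sub_add_cancel, zero_add] using h

/-- **S5 ⇒ Cardy for `M₁`** (through the landed S6 `stub_flatOfSymmetry` and S7b). -/
theorem bondEndCrossings_of_uniformAttachmentSymmetry (h5 : UniformAttachmentSymmetry) :
    BondEndCrossings :=
  bondEndCrossings_of_hexSegmentFlat (stub_flatOfSymmetry h5)

/-- **S5b ⇒ Cardy for `M₁`**: the research statement of the line, in its sharp form, already yields
Cardy's formula for critical bond percolation on `𝕋̃` at crossing level (crude discretisation, every
conformal rectangle), unconditionally in everything else. -/
theorem bondEndCrossings_of_influenceVanishes : InfluenceVanishes → BondEndCrossings :=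
  fun h5b ↦
    bondEndCrossings_of_uniformAttachmentSymmetry (uniformAttachmentSymmetry_of_influenceVanishes h5b)

/-! ## §2 The loop-level gluing at the bond end: `BondEndLoops` ⇒ `SegmentLoops` -/

/-- Measurability of the exceptional event of `d_CN` between two segment ensembles (from the landed
S3 `stub_coinMeasurable`: it is the preimage under `(refine ∘ cfg) × (refine ∘ cfg)` of the site/site
event `measurableSet_isClose_siteLoopConfig`). -/
theorem measurableSet_isClose_seg_seg (δ δ' ε : ℝ) :
    MeasurableSet {p : Set Coin × Set Coin |
      LoopConfig.IsClose ε (segLoops δ p.1) (segLoops δ' p.2)} := by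
  have hm : Measurable (Prod.map (refine ∘ cfg) (refine ∘ cfg)) :=
    (stub_coinMeasurable.2.comp stub_coinMeasurable.1).prodMap
      (stub_coinMeasurable.2.comp stub_coinMeasurable.1)
  exact hm (measurableSet_isClose_siteLoopConfig (δ / 2) (δ' / 2) ε)

/-- **`BondEndLoops` ⇒ `SegmentLoops`**: if `M₁` merges with site-`𝕋` at loop level then `M₁` merges
with `M₀`, because `M₀` does (the landed S2 `stub_siteEnd`) and `d_CN` satisfies the triangle
inequality through the site-`𝕋` presentation:
`d_CN(M₁, M₀) ≤ d_CN(M₁, 𝕋) + d_CN(𝕋, M₀) → 0 + 0` (`cnLawEDist_triangle`, `cnLawEDist_comm`). -/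
theorem segmentLoops_of_bondEndLoops : BondEndLoops → SegmentLoops := by
  intro h1
  haveI := standardBorelSpace_siteConfig
  haveI := standardBorelSpace_coin
  have h0 := stub_siteEnd
  show Tendsto (fun δ : ℝ ↦ LoopConfig.cnLawEDist (prodBernoulli (prm 1)) (segLoops δ)
    (prodBernoulli (prm 0)) (segLoops δ)) (𝓝[>] 0) (𝓝 0)
  have hle : ∀ δ : ℝ, LoopConfig.cnLawEDist (prodBernoulli (prm 1)) (segLoops δ)
      (prodBernoulli (prm 0)) (segLoops δ) ≤
      LoopConfig.cnLawEDist (prodBernoulli (prm 1)) (segLoops δ) (triSitePercolation half)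
        (siteLoopConfig δ) +
      LoopConfig.cnLawEDist (prodBernoulli (prm 0)) (segLoops δ) (triSitePercolation half)
        (siteLoopConfig δ) := by
    intro δ
    calc LoopConfig.cnLawEDist (prodBernoulli (prm 1)) (segLoops δ) (prodBernoulli (prm 0)) (segLoops δ)
        ≤ LoopConfig.cnLawEDist (prodBernoulli (prm 1)) (segLoops δ) (triSitePercolation half)
            (siteLoopConfig δ) +
          LoopConfig.cnLawEDist (triSitePercolation half) (siteLoopConfig δ) (prodBernoulli (prm 0))
            (segLoops δ) :=
          LoopConfig.cnLawEDist_triangle _ _ _ _ _ _ (measurableSet_isClose_seg_seg δ δ)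
      _ = _ := by rw [LoopConfig.cnLawEDist_comm (triSitePercolation half) (siteLoopConfig δ)]
  have hlim := h1.add h0
  simp only [add_zero] at hlim
  exact tendsto_of_tendsto_of_tendsto_of_le_of_le tendsto_const_nhds hlim (fun _ ↦ bot_le) hle

/-! ## §3 The crux from the residual statements -/

/-- **The crux factors through two loop-level universality statements.** `TriToSquareLoops`
(bond-`ℤ²` ~ bond-`𝕋̃`) and `BondEndLoops` (bond-`𝕋̃`, presented as `M₁`, ~ site-`𝕋`) imply
`LoopLimitZ2EqT`, by the landed chain glue `loopLimitZ2EqT_of_stubs` fed with the landed S1, S2, S3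
and `segmentLoops_of_bondEndLoops`:
`d_CN(ℤ², 𝕋) ≤ d_CN(ℤ², 𝕋̃) + d_CN(M₁, M₀) + d_CN(M₀, 𝕋) → 0`. -/
theorem loopLimitZ2EqT_of_bondEndLoops : TriToSquareLoops → BondEndLoops → LoopLimitZ2EqT :=
  fun h4 h1 ↦
    loopLimitZ2EqT_of_stubs stub_bondEnd stub_siteEnd stub_coinMeasurable h4
      (segmentLoops_of_bondEndLoops h1)

/-- **Conditional closure of `LoopLimitZ2EqT` along line `Sketch`** — the registered skeleton's
composition, sorry-free, with its three open stubs as hypotheses: S4 `TriToSquareLoops`, S5b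
`InfluenceVanishes`, S7c `CardyToCLE`. Chain: S5b ⇒ Cardy for `M₁` at crossing level
(`bondEndCrossings_of_influenceVanishes`, through the landed S5a, S6, S7a) ⇒ `BondEndLoops` (S7c)
⇒ the crux (`loopLimitZ2EqT_of_bondEndLoops`, through the landed S1, S2, S3 and glue). -/
theorem loopLimitZ2EqT_of_residuals : TriToSquareLoops → InfluenceVanishes → CardyToCLE → LoopLimitZ2EqT :=
  fun h4 h5b h7c ↦
    loopLimitZ2EqT_of_bondEndLoops h4 (h7c (bondEndCrossings_of_influenceVanishes h5b))

/-- **Conditional closure over S5** (`UniformAttachmentSymmetry`, the derivative form of the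
research statement) instead of S5b. -/
theorem loopLimitZ2EqT_of_residuals' :
    TriToSquareLoops → UniformAttachmentSymmetry → CardyToCLE → LoopLimitZ2EqT :=
  fun h4 h5 h7c ↦
    loopLimitZ2EqT_of_bondEndLoops h4 (h7c (bondEndCrossings_of_uniformAttachmentSymmetry h5))

end Summit.CriticalPhenomena.CardyFormulaZ2.Cruxes.LoopLimitZ2EqT.HexSegment

end
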